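import Summits.BirchSwinnertonDyer.BirchSwinnertonDyer.Theorems.GenusKolyvaginAtTwoShaRatCardOfKFour
import Summits.BirchSwinnertonDyer.BirchSwinnertonDyer.Theorems.GenusKolyvaginAtTwoShaConsistencyLawFreeCurrency
import HarnessLib

/-!
# Route `GenusKolyvaginAtTwo`, crux K₄⁺ `K4Pos` (stmt-BirchSwinnertonDyer-31469) — THE DIVISIBILITY CURRENCY OF K₄⁺ (pairing-free):
# on the K₄⁺ cut cell, mod Q2, K4Pos-at-`E` ⟺ every `2`-torsion class of `Ш(E/ℚ)` is `2^(M₀−1)`-divisible IN `Ш(E/ℚ)`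
# (depth two: `Ш(E/ℚ)[2] ⊆ 2·Ш(E/ℚ)`)

Width seat `bsd-line-gk2-p5` g37 (cell `bsd-f1-sign2`), `--supports stmt-BirchSwinnertonDyer-31469 --as helper`.  THEOREMS ONLY (no definition, no
named fact, no `sorry`); standard axioms.  **BSD is NOT proved by this file; K4Pos is NOT proved; nothing is closed.**

WHY.  LEAD-BRIEF-g23-ADDENDUM B.4 / LEAD-BRIEF-g24 §4 price K₄ at depth two as «`Ш(E/ℚ)[2] ⊂ 2·Ш(E/ℚ)[4]` ⟺ (Cassels) the Cassels–Tate pairing on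
`Sel₂(E/ℚ)` vanishes».  The first half of that chain needs NO pairing: it is group theory on the one-block structure `Ш(E/ℚ)[2^∞] ≃ (ℤ/2^e)²`
(gk2-p4 g29 `ShaCores.exists_addEquiv_shaPrimary_of_kFourPos_cut`, `1 ≤ e ≤ M₀`, mod Q2).  This file lands it for every depth:
* §1 `ZMod`: in `ℤ/2^e`, `2^(e−j)·x = 0 ⟹ x ∈ 2^j·(ℤ/2^e)` (`exists_eq_nsmul_of_nsmul_eq_zero_zmod_two_pow`, and the square); hence
  `forall_two_nsmul_eq_zero_exists_eq_nsmul_zmod_sq_iff` — **in `(ℤ/2^e)²` (`e ≥ 1`) every `2`-torsion element is `2^j`-divisible iff `j < e`**.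
* §2 ★ `kFourPos_witness_iff_sha_two_torsion_divisible_of_cut` — on gk2-p4's K₄⁺ cut frame VERBATIM (mod Q2, `M₀ ≥ 1`): **K4Pos witness ⟺
  `∀ a ∈ Ш(E/ℚ), 2·a = 0 → ∃ b ∈ Ш(E/ℚ), 2^(M₀−1)·b = a`**; depth two (`M₀ = 2`): **⟺ `Ш(E/ℚ)[2] ⊆ 2·Ш(E/ℚ)`**
  (`kFourPos_witness_iff_sha_two_torsion_two_divisible_of_depth_two`).  The remaining step to the CT INSTRUMENT («`a ∈ 2^j·Ш ⟺ a ⊥ Ш[2^j]`», Cassels)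
  is gk2-p4 g29's lane (LEAD 13:17Z) and is NOT done here.
BSD is NOT proved by any of this.

References: [Cassels1962ArithmeticIV] §1; [McCallumLMS1991] §5 Thm. 5.4; [Kolyvagin1989Izv] Thm. B₂; [Fuchs1970] Ch. I §1; [Hungerford1974] Ch. II Lemma 2.5.
-/

set_option autoImplicit false
-- the Theorems namespace of this sub repeats the summit name by design (D-0017 nested layout)
set_option linter.dupNamespace false

noncomputable section

open scoped Classical
open scoped AddSubgroup

namespace Summit.BirchSwinnertonDyer.BirchSwinnertonDyer.Theorems.GenusExact.PlusDescent

open WeierstrassCurve NumberField IsDedekindDomain Field Literature.NumberTheory.EllipticCurves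
  Literature.NumberTheory.GaloisRepresentations Literature.NumberTheory.EllipticCurves.ModularForms AddSubgroup
  Literature.NumberTheory.EllipticCurves.RingClassField
open Summit.BirchSwinnertonDyer.BirchSwinnertonDyer.Theses.GenusKolyvaginAtTwo (KolyvaginRelationAtTwo)
open Summit.BirchSwinnertonDyer.BirchSwinnertonDyer.Theorems.GenusExact.ShaCores
  (exists_addEquiv_shaPrimary_of_kFourPos_cut kFourPos_witness_iff_natCard_shaPrimary_rat_eq_pow forall_nsmul_zmod_prod_eq_zero_iff)

/-! ## §1 Divisibility in `ℤ/2^e` and `(ℤ/2^e)²` -/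

/-- In `ℤ/2^e`: `2^(e−j)·x = 0` (`j ≤ e`) ⟹ `x = 2^j·y` for some `y`. [cite: Hungerford1974, Ch. II Lemma 2.5] -/
theorem exists_eq_nsmul_of_nsmul_eq_zero_zmod_two_pow {e j : ℕ} (hj : j ≤ e) (x : ZMod (2 ^ e)) (hx : 2 ^ (e - j) • x = 0) :
    ∃ y : ZMod (2 ^ e), x = 2 ^ j • y := by
  haveI : NeZero (2 ^ e) := ⟨pow_ne_zero e two_ne_zero⟩
  -- `2^e ∣ 2^(e−j) · x.val`, hence `2^j ∣ x.val`
  have h0 : (((2 ^ (e - j) * x.val : ℕ)) : ZMod (2 ^ e)) = 0 := by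
    rw [Nat.cast_mul, ZMod.natCast_zmod_val, ← nsmul_eq_mul, hx]
  have hdvd : 2 ^ e ∣ 2 ^ (e - j) * x.val := (ZMod.natCast_eq_zero_iff _ _).mp h0
  have hdvd' : 2 ^ j ∣ x.val := by
    have h2 : 2 ^ (e - j) * 2 ^ j ∣ 2 ^ (e - j) * x.val := by
      rwa [← pow_add, Nat.sub_add_cancel hj]
    exact Nat.dvd_of_mul_dvd_mul_left (pow_pos two_pos _) h2
  obtain ⟨q, hq⟩ := hdvd'
  refine ⟨(q : ZMod (2 ^ e)), ?_⟩
  rw [nsmul_eq_mul, ← Nat.cast_mul, ← hq, ZMod.natCast_zmod_val]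

/-- In `(ℤ/2^e)²`: `2^(e−j)·x = 0` (`j ≤ e`) ⟹ `x = 2^j·y` for some `y`. [cite: Hungerford1974, Ch. II Lemma 2.5] [cite: Fuchs1970, Ch. I §1] -/
theorem exists_eq_nsmul_of_nsmul_eq_zero_zmod_sq_two_pow {e j : ℕ} (hj : j ≤ e) (x : ZMod (2 ^ e) × ZMod (2 ^ e))
    (hx : 2 ^ (e - j) • x = 0) : ∃ y : ZMod (2 ^ e) × ZMod (2 ^ e), x = 2 ^ j • y := by
  obtain ⟨y₁, h₁⟩ := exists_eq_nsmul_of_nsmul_eq_zero_zmod_two_pow hj x.1 (by rw [← Prod.smul_fst, hx, Prod.fst_zero])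
  obtain ⟨y₂, h₂⟩ := exists_eq_nsmul_of_nsmul_eq_zero_zmod_two_pow hj x.2 (by rw [← Prod.smul_snd, hx, Prod.snd_zero])
  exact ⟨(y₁, y₂), Prod.ext (by rw [Prod.smul_fst]; exact h₁) (by rw [Prod.smul_snd]; exact h₂)⟩

/-- **In `(ℤ/2^e)²` with `e ≥ 1`, every `2`-torsion element is `2^j`-divisible iff `j < e`.** (⟸: a `2`-torsion `x` has `2^(e−(e−1))·x = 0`, so
`x = 2^(e−1)·y = 2^j·(2^(e−1−j)·y)`; ⟹: `(2^(e−1), 0)` is `2`-torsion and non-zero, while `2^j·(ℤ/2^e)² = 0` for `j ≥ e`.) [cite: Fuchs1970, Ch. I §1] -/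
theorem forall_two_nsmul_eq_zero_exists_eq_nsmul_zmod_sq_iff {e : ℕ} (he : 1 ≤ e) (j : ℕ) :
    (∀ x : ZMod (2 ^ e) × ZMod (2 ^ e), 2 • x = 0 → ∃ y : ZMod (2 ^ e) × ZMod (2 ^ e), x = 2 ^ j • y) ↔ j < e := by
  haveI : NeZero (2 ^ e) := ⟨pow_ne_zero e two_ne_zero⟩
  constructor
  · intro h
    by_contra hle
    push Not at hle
    -- the non-zero `2`-torsion element `(2^(e−1), 0)`
    set x₀ : ZMod (2 ^ e) × ZMod (2 ^ e) := (((2 ^ (e - 1) : ℕ) : ZMod (2 ^ e)), 0) with hx₀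
    have h2x₀ : 2 • x₀ = 0 := by
      refine Prod.ext ?_ ?_
      · change 2 • (((2 ^ (e - 1) : ℕ)) : ZMod (2 ^ e)) = 0
        rw [nsmul_eq_mul, ← Nat.cast_mul, ZMod.natCast_eq_zero_iff]
        exact ⟨1, by rw [mul_one, ← pow_succ', Nat.sub_add_cancel he]⟩
      · change 2 • (0 : ZMod (2 ^ e)) = 0
        exact smul_zero _
    have hx₀ne : x₀ ≠ 0 := by
      intro h0
      have h1 : (((2 ^ (e - 1) : ℕ)) : ZMod (2 ^ e)) = 0 := congrArg Prod.fst h0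
      rw [ZMod.natCast_eq_zero_iff] at h1
      have := Nat.le_of_dvd (pow_pos two_pos _) h1
      have hlt : 2 ^ (e - 1) < 2 ^ e := Nat.pow_lt_pow_right (by norm_num) (by omega)
      omega
    obtain ⟨y, hy⟩ := h x₀ h2x₀
    have hkill := (forall_nsmul_zmod_prod_eq_zero_iff e j).mpr hle y
    exact hx₀ne (by rw [hy, hkill])
  · intro hlt x hx
    obtain ⟨y, hy⟩ := exists_eq_nsmul_of_nsmul_eq_zero_zmod_sq_two_pow (Nat.sub_le e 1) x
      (by rw [show e - (e - 1) = 1 by omega, pow_one]; exact hx)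
    refine ⟨2 ^ (e - 1 - j) • y, ?_⟩
    rw [hy, ← mul_nsmul, ← pow_add, Nat.sub_add_cancel (by omega : j ≤ e - 1)]

/-! ## §2 ★ K4Pos ⟺ every `2`-torsion class of `Ш(E/ℚ)` is `2^(M₀−1)`-divisible in `Ш(E/ℚ)` (cut cell, mod Q2) -/

section KFourPos

variable (W : WeierstrassCurve ℚ) [W.IsElliptic] [W.IsGloballyMinimal] [NeZero (W.conductorNorm ℤ)]
variable (K : Type) [Field K] [NumberField K]

/-- ★ **THE DIVISIBILITY CURRENCY OF K₄⁺ (pairing-free).**  On gk2-p4 g29's K₄⁺ cut cell frame VERBATIM (globally minimal non-CM `E/ℚ`, odd Tamagawa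
product, an odd multiplicative prime `v`, `Δ > 0`; `K` imaginary quadratic, `d_K` odd `≠ −3`, Heegner, the two B₂ non-squares, `ρ_{E,2^n}` onto; a
datum with `P(1)` of infinite order and `2^(M₀) ∥ P(1)`, `M₀ ≥ 1`; a shallow twin `Wd = Cd • E^(d_K)`, `#Sel₂(Wd) = 2`, `ord₂ C(Wd) = 0`; the K₄⁺ clause;
`r_an(E) = 0`; `2` split; `σ₀ ≠ 1`), modulo Q2: **a K4Pos witness EXISTS iff every `2`-torsion class of `Ш(E/ℚ)` is `2^(M₀−1)`-divisible inside `Ш(E/ℚ)`**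
(`∀ a ∈ Ш(E/ℚ), 2·a = 0 → ∃ b ∈ Ш(E/ℚ), 2^(M₀−1)·b = a`).  Proof: `Ш(E/ℚ)[2^∞] ≃ (ℤ/2^e)²` with `1 ≤ e ≤ M₀` and the witness ⟺ `#Ш(E/ℚ)[2^∞] = 4^(M₀)`
⟺ `e = M₀` (gk2-p4 ★★); by §1 the divisibility holds iff `M₀ − 1 < e` iff `e = M₀`.  The step «`a ∈ 2^j·Ш ⟺ a ⊥ Ш[2^j]` under Cassels–Tate» that
turns this into a computable pairing test is NOT taken here.  BSD / K4Pos are NOT proved by this. [cite: Cassels1962ArithmeticIV, §1]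
[cite: McCallumLMS1991, §5 Thm. 5.4] [cite: Kolyvagin1989Izv, Thm. B₂] -/
theorem kFourPos_witness_iff_sha_two_torsion_divisible_of_cut (hQ2 : KolyvaginRelationAtTwo) (hcm : ¬ W.HasCM)
    (hT : Odd W.tamagawaProduct) (v : HeightOneSpectrum (𝓞 ℚ)) (h2v : ((2 : ℕ) : 𝓞 ℚ) ∉ v.asIdeal)
    (hNv : ((W.conductorNorm ℤ : ℕ) : 𝓞 ℚ) ∈ v.asIdeal) (hmult : W.HasMultiplicativeReductionAt v) (hpos : 0 < W.Δ)
    (hIQ : IsImaginaryQuadratic K) (hodd : Odd (NumberField.discr K))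
    (h3 : NumberField.discr K ≠ -3) (hHe : SatisfiesHeegnerHypothesis (W.conductorNorm ℤ) K)
    (hsq1 : ¬ IsSquare ((NumberField.discr K : ℚ) * -|W.Δ|)) (hsq2 : ¬ IsSquare ((NumberField.discr K : ℚ) * (-(2 * |W.Δ|))))
    (hρ : ∀ n : ℕ, 0 < n → W.HasSurjectiveModNGaloisRep ((2 : ℤ) ^ n))
    (Dt : ModularParametrizationData W (W.conductorNorm ℤ)) (β : ℤ) (ι : K →+* ℂ) (d₁ : KolyvaginHeegnerData Dt β ι 1)
    (hy : ¬ IsOfFinAddOrder d₁.derivedPoint) (M₀ : ℕ) (hM₀ : 1 ≤ M₀)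
    (hdiv : ∃ Q : (W.baseChange (ringClassField K ι 1)).toAffine.Point, ((2 ^ M₀ : ℕ) : ℤ) • Q = d₁.derivedPoint)
    (hndiv : ¬ ∃ Q : (W.baseChange (ringClassField K ι 1)).toAffine.Point, ((2 ^ (M₀ + 1) : ℕ) : ℤ) • Q = d₁.derivedPoint)
    (Wd : WeierstrassCurve ℚ) [Wd.IsElliptic] [Wd.IsGloballyMinimal] (Cd : VariableChange ℚ) (hCd : Cd • W.quadraticTwist (discr K : ℚ) = Wd)
    (hSel : Nat.card (Wd.selmerGroup 2) = 2) (hDEF : padicValNat 2 Wd.tamagawaProduct = 0)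
    (h4 : Nat.card (W.selmerGroup 2) = 4 ∧ ∃ c ∈ (W.kummerSelmerStructure ((2 : ℕ) : ℤ)).selmerGroup,
      galoisCohomology.localization (W.torsionGaloisModule ((2 : ℕ) : ℤ)) (Sum.inl Rat.infinitePlace) 1 c ≠ 0)
    (hr0 : W.analyticRank = 0) (h2K : ((Ideal.span {(2 : ℤ)}).primesOver (𝓞 K)).ncard = 2) {σ₀ : K ≃ₐ[ℚ] K} (hσ₀ : σ₀ ≠ 1) :
    (∃ (n : ℕ) (d : KolyvaginHeegnerData Dt β ι n), Squarefree n ∧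
      (∀ ℓ ∈ n.primeFactors, Zhang2014.IsKolyvaginPrime (W.conductorNorm ℤ) W K 2 ℓ ∧ 2 ≤ Zhang2014.kolyvaginIndex W 2 ℓ ∧
        ∃ (v : HeightOneSpectrum (𝓞 ℚ)) (𝔓 : Ideal (absIntegers (𝓞 ℚ) ℚ)) (h : absoluteGaloisGroup ℚ),
          ((ℓ : ℕ) : 𝓞 ℚ) ∈ v.asIdeal ∧ 𝔓 ∈ v.primesAbove ∧ IsArithFrobAt (𝓞 ℚ) h 𝔓 ∧ ∃ u : W.geomTorsion ((2 : ℕ) : ℤ), h • u ≠ u) ∧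
      ¬ ∃ Q : (W.baseChange (ringClassField K ι n)).toAffine.Point, (2 : ℤ) • Q = d.derivedPoint) ↔
    ∀ a : W.galH1, a ∈ W.sha → (2 : ℤ) • a = 0 → ∃ b : W.galH1, b ∈ W.sha ∧ ((2 ^ (M₀ - 1) : ℕ) : ℤ) • b = a := by
  haveI : Fact (Nat.Prime 2) := ⟨Nat.prime_two⟩
  obtain ⟨e, he1, heM, -, ⟨eY⟩, -, hYe⟩ := exists_addEquiv_shaPrimary_of_kFourPos_cut W K hQ2 hcm hT v h2v hNv hmult hpos hIQ hodd h3 hHe hsq1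
    hsq2 hρ Dt β ι d₁ hy M₀ hdiv hndiv Wd Cd hCd hSel hDEF h4 hr0 h2K hσ₀
  rw [kFourPos_witness_iff_natCard_shaPrimary_rat_eq_pow W K hQ2 hcm hT v h2v hNv hmult hpos hIQ hodd h3 hHe hsq1 hsq2 hρ Dt β ι d₁ hy M₀ hM₀ hdiv
    hndiv Wd Cd hCd hSel hDEF h4 hr0 h2K hσ₀, hYe]
  -- `4^e = 4^M₀ ↔ e = M₀ ↔ M₀ − 1 < e ↔` (§1) every `2`-torsion element of `(ℤ/2^e)²` is `2^(M₀−1)`-divisible `↔` the same in `Ш(E/ℚ)`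
  have key : (4 ^ e = 4 ^ M₀) ↔ M₀ - 1 < e := by
    constructor
    · intro h
      have := Nat.pow_right_injective (by norm_num : 2 ≤ 4) h
      omega
    · intro h
      have : e = M₀ := by omega
      rw [this]
  rw [key, ← forall_two_nsmul_eq_zero_exists_eq_nsmul_zmod_sq_iff he1 (M₀ - 1)]
  constructor
  · -- from `(ℤ/2^e)²` to `Ш(E/ℚ)`
    intro h a ha h2a
    have h2a' : (2 : ℕ) • a = 0 := by rw [← natCast_zsmul]; exact_mod_cast h2a
    have hsha2 : 2 • (⟨a, ha⟩ : ↥W.sha) = 0 :=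
      Subtype.ext (by simp only [AddSubgroupClass.coe_nsmul, ZeroMemClass.coe_zero]; exact h2a')
    have haP : (⟨a, ha⟩ : ↥W.sha) ∈ AddCommGroup.primaryComponent (↥W.sha) 2 :=
      (AddCommGroup.mem_primaryComponent).mpr ⟨1, by rw [pow_one]; exact hsha2⟩
    have h2x : 2 • eY ⟨⟨a, ha⟩, haP⟩ = 0 := by
      rw [← map_nsmul, eY.map_eq_zero_iff]
      exact Subtype.ext (by simp only [AddSubgroupClass.coe_nsmul, ZeroMemClass.coe_zero]; exact hsha2)
    obtain ⟨y, hy⟩ := h _ h2x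
    refine ⟨((eY.symm y : ↥W.sha) : W.galH1), (eY.symm y : ↥W.sha).2, ?_⟩
    have hxy : (⟨⟨a, ha⟩, haP⟩ : AddCommGroup.primaryComponent (↥W.sha) 2) = 2 ^ (M₀ - 1) • eY.symm y := by
      apply eY.injective
      rw [map_nsmul, AddEquiv.apply_symm_apply, ← hy]
    have h' := congrArg (fun z : AddCommGroup.primaryComponent (↥W.sha) 2 ↦ ((z : ↥W.sha) : W.galH1)) hxy
    simp only [AddSubgroupClass.coe_nsmul] at h'
    -- `h' : a = 2 ^ (M₀ - 1) • ↑↑(eY.symm y)`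
    rw [natCast_zsmul]
    exact h'.symm
  · -- from `Ш(E/ℚ)` to `(ℤ/2^e)²`
    intro h x hx
    have h2z : 2 • eY.symm x = 0 := by
      apply eY.injective
      rw [map_nsmul, AddEquiv.apply_symm_apply, hx, map_zero]
    have h2a : (2 : ℤ) • (((eY.symm x : AddCommGroup.primaryComponent (↥W.sha) 2) : ↥W.sha) : W.galH1) = 0 := by
      have h' := congrArg (fun t : AddCommGroup.primaryComponent (↥W.sha) 2 ↦ ((t : ↥W.sha) : W.galH1)) h2z
      simp only [AddSubgroupClass.coe_nsmul, ZeroMemClass.coe_zero] at h'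
      rw [← natCast_zsmul] at h'
      exact_mod_cast h'
    obtain ⟨b, hb, hba⟩ := h _ ((eY.symm x : AddCommGroup.primaryComponent (↥W.sha) 2) : ↥W.sha).2 h2a
    -- `b` is `2`-primary (`2^M₀ • b = 2 • (2^(M₀−1) • b) = 0`)
    have h2M : ((2 ^ M₀ : ℕ) : ℤ) • b = 0 := by
      rw [show ((2 ^ M₀ : ℕ) : ℤ) = 2 * ((2 ^ (M₀ - 1) : ℕ) : ℤ) by
        push_cast; rw [← pow_succ', Nat.sub_add_cancel hM₀], mul_smul, hba, h2a]
    have hbP : (⟨b, hb⟩ : ↥W.sha) ∈ AddCommGroup.primaryComponent (↥W.sha) 2 := by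
      refine (AddCommGroup.mem_primaryComponent).mpr ⟨M₀, Subtype.ext ?_⟩
      simp only [AddSubgroupClass.coe_nsmul, ZeroMemClass.coe_zero]
      rw [← natCast_zsmul]
      exact h2M
    refine ⟨eY ⟨⟨b, hb⟩, hbP⟩, ?_⟩
    apply eY.symm.injective
    rw [map_nsmul, AddEquiv.symm_apply_apply]
    apply Subtype.ext; apply Subtype.ext
    simp only [AddSubgroupClass.coe_nsmul]
    rw [← natCast_zsmul]
    exact hba.symm

/-- **DEPTH TWO: K4Pos witness ⟺ `Ш(E/ℚ)[2] ⊆ 2·Ш(E/ℚ)`** on the `M₀ = 2` K₄⁺ cut cell (mod Q2) — LEAD-BRIEF-g23-ADDENDUM B.4's form, pairing-free.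
BSD / K4Pos are NOT proved by this. [cite: Cassels1962ArithmeticIV, §1] [cite: McCallumLMS1991, §5 Thm. 5.4] -/
theorem kFourPos_witness_iff_sha_two_torsion_two_divisible_of_depth_two (hQ2 : KolyvaginRelationAtTwo) (hcm : ¬ W.HasCM)
    (hT : Odd W.tamagawaProduct) (v : HeightOneSpectrum (𝓞 ℚ)) (h2v : ((2 : ℕ) : 𝓞 ℚ) ∉ v.asIdeal)
    (hNv : ((W.conductorNorm ℤ : ℕ) : 𝓞 ℚ) ∈ v.asIdeal) (hmult : W.HasMultiplicativeReductionAt v) (hpos : 0 < W.Δ)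
    (hIQ : IsImaginaryQuadratic K) (hodd : Odd (NumberField.discr K))
    (h3 : NumberField.discr K ≠ -3) (hHe : SatisfiesHeegnerHypothesis (W.conductorNorm ℤ) K)
    (hsq1 : ¬ IsSquare ((NumberField.discr K : ℚ) * -|W.Δ|)) (hsq2 : ¬ IsSquare ((NumberField.discr K : ℚ) * (-(2 * |W.Δ|))))
    (hρ : ∀ n : ℕ, 0 < n → W.HasSurjectiveModNGaloisRep ((2 : ℤ) ^ n))
    (Dt : ModularParametrizationData W (W.conductorNorm ℤ)) (β : ℤ) (ι : K →+* ℂ) (d₁ : KolyvaginHeegnerData Dt β ι 1)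
    (hy : ¬ IsOfFinAddOrder d₁.derivedPoint)
    (hdiv : ∃ Q : (W.baseChange (ringClassField K ι 1)).toAffine.Point, ((2 ^ 2 : ℕ) : ℤ) • Q = d₁.derivedPoint)
    (hndiv : ¬ ∃ Q : (W.baseChange (ringClassField K ι 1)).toAffine.Point, ((2 ^ (2 + 1) : ℕ) : ℤ) • Q = d₁.derivedPoint)
    (Wd : WeierstrassCurve ℚ) [Wd.IsElliptic] [Wd.IsGloballyMinimal] (Cd : VariableChange ℚ) (hCd : Cd • W.quadraticTwist (discr K : ℚ) = Wd)
    (hSel : Nat.card (Wd.selmerGroup 2) = 2) (hDEF : padicValNat 2 Wd.tamagawaProduct = 0)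
    (h4 : Nat.card (W.selmerGroup 2) = 4 ∧ ∃ c ∈ (W.kummerSelmerStructure ((2 : ℕ) : ℤ)).selmerGroup,
      galoisCohomology.localization (W.torsionGaloisModule ((2 : ℕ) : ℤ)) (Sum.inl Rat.infinitePlace) 1 c ≠ 0)
    (hr0 : W.analyticRank = 0) (h2K : ((Ideal.span {(2 : ℤ)}).primesOver (𝓞 K)).ncard = 2) {σ₀ : K ≃ₐ[ℚ] K} (hσ₀ : σ₀ ≠ 1) :
    (∃ (n : ℕ) (d : KolyvaginHeegnerData Dt β ι n), Squarefree n ∧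
      (∀ ℓ ∈ n.primeFactors, Zhang2014.IsKolyvaginPrime (W.conductorNorm ℤ) W K 2 ℓ ∧ 2 ≤ Zhang2014.kolyvaginIndex W 2 ℓ ∧
        ∃ (v : HeightOneSpectrum (𝓞 ℚ)) (𝔓 : Ideal (absIntegers (𝓞 ℚ) ℚ)) (h : absoluteGaloisGroup ℚ),
          ((ℓ : ℕ) : 𝓞 ℚ) ∈ v.asIdeal ∧ 𝔓 ∈ v.primesAbove ∧ IsArithFrobAt (𝓞 ℚ) h 𝔓 ∧ ∃ u : W.geomTorsion ((2 : ℕ) : ℤ), h • u ≠ u) ∧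
      ¬ ∃ Q : (W.baseChange (ringClassField K ι n)).toAffine.Point, (2 : ℤ) • Q = d.derivedPoint) ↔
    ∀ a : W.galH1, a ∈ W.sha → (2 : ℤ) • a = 0 → ∃ b : W.galH1, b ∈ W.sha ∧ (2 : ℤ) • b = a := by
  have h := kFourPos_witness_iff_sha_two_torsion_divisible_of_cut W K hQ2 hcm hT v h2v hNv hmult hpos hIQ hodd h3 hHe hsq1 hsq2 hρ Dt β ι d₁ hy 2
    (by norm_num) hdiv hndiv Wd Cd hCd hSel hDEF h4 hr0 h2K hσ₀
  have e2 : ((2 ^ (2 - 1) : ℕ) : ℤ) = 2 := by norm_num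
  rw [e2] at h
  exact h

end KFourPos

end Summit.BirchSwinnertonDyer.BirchSwinnertonDyer.Theorems.GenusExact.PlusDescent

end
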